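import Literature.MathematicalPhysics.QuantumFieldTheory.IsingGaugeDualityThree
import Literature.MathematicalPhysics.QuantumFieldTheory.IsingGaugeDeconfinementTransition
import Literature.Probability.LatticeModels.IsingDisorderOperatorFK
import Literature.Probability.LatticeModels.IsingTransport
import Literature.Probability.LatticeModels.PlusFreeComparison
import Literature.Probability.LatticeModels.GibbsStatesProofs
import Literature.Probability.LatticeModels.SusceptibilityMeanFieldBound
import Literature.Probability.LatticeModels.SharpnessLROProofs
import Literature.Probability.LatticeModels.SharpnessProofs
import Mathlib.Algebra.Order.Field.GeomSum
import HarnessLib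

/-!
# The deconfinement (perimeter-law) half of Aizenman's sharp transition for `ℤ₂` lattice gauge
# theory on `ℤ³` — proved

M. Aizenman, *Geometric analysis of Ising models, Part III*, Math. Phys. Anal. Geom. **28** (2025)
= arXiv:2509.02850 [Aizenman2025], §9.1 **Theorem 9.1**, second line:
«`β > β_c ⟹ ⟨∏_{b ∈ ∂γ_ℓ} A_b⟩_{ℤ³,β} ≥ e^{-m(β) ℓ}` at `m(β) < ∞`», `coth β_c = e^{2β_c^{Ising}}`,
proved in §9.3 of the source («the deconfinement lower bound»).

The tree's named fact `Aizenman2025_z2GaugeThree_sharpTransition`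
(`IsingGaugeDeconfinementTransition.lean`) is the conjunction of the two lines of Thm 9.1 for the
infinite-volume free-boundary `ℤ₂` Wilson loop `znWilsonLoopLimit 2 β x 0 1 ℓ ℓ`. This file PROVES
its second conjunct, `Aizenman2025_z2GaugeThree_perimeterLaw`, from tree theorems only, along the
printed proof:

1. **Duality** (Thm 9.2; tree theorem
   `Z2Duality.zdExpect_z2_wilsonLoop_eq_isingExpect_plus_disorderWeight`,
   `IsingGaugeDualityThree.lean`): on every gauge box the Wilson loop expectation is the
   PLUS-boundary Ising expectation, on the box of cubes, of the disorder operator `T_S` of the dual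
   bonds of the sheet, at the dual temperature `β*`, `e^{-2β*} = tanh β`; and
   `β > β_c ⟹ β* < β_c^{Ising}(ℤ³)` (`dualBeta_lt_criticalBeta`).
2. **The FK ∕ FKG cylinder bound** (§9.3 of the source; tree theorem
   `DisorderFK.exp_mul_sum_twoPoint_le_disorder_square` of `IsingDisorderOperatorFK.lean`: Thm 8.1
   and the chain `⟨T_S⟩ ≥ ∏∏ (1 - ⟨σ_uσ_v⟩) ≥ exp[-λ ΣΣ ⟨σ_uσ_v⟩]` over the two walls of the cylinder,
   stated for the FREE-boundary Ising model on a finite region), transported to the volume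
   vocabulary `isingExpect (zdGraph 3) Λ β 0 .free` (`IsingTransport.isingExpect_free_map`).
3. **Exponential decay of the dual two-point function** («by the known sharpness of the Ising
   model's phase transition [ABF87]»; tree theorem `twoPoint_exponentialDecay_of_lt_criticalBeta_holds`
   — Duminil-Copin–Tassion's proof, `SharpnessDecayProofs.lean`), with Griffiths' monotonicity in
   the volume (`isingCorr_free_box_le_freeCorr`): the double sum over the two walls is at most
   `K (R + T)` uniformly in the volume (`wallSum_le`; the walls have `≤ 2(R+T)` columns and the
   vertical decay is summed geometrically).
4. **Free versus plus boundary condition, in infinite volume.** The printed proof works with the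
   unique infinite-volume state of the dual model at `β* < β_c^{Ising}`. In the tree the free gauge
   box dualises to the PLUS Ising box (step 1) while step 2 is a free-boundary statement; the two
   are reconciled in infinite volume: `T_S` is a finite linear combination of spin products
   (`disorderWeight_sheet_eq_sum`), the plus and free box limits of spin products exist
   (`hasBoxLimit_isingCorr_plus_holds`, `hasBoxLimit_isingCorr_free_holds`, GKS) and agree when
   `m*(β*) = 0` (Lebowitz–Martin-Löf, tree theorem
   `freeCorr_eq_plusCorr_of_spontaneousMagnetization_eq_zero`; `m*(β*) = 0` for `β* < β_c` by the
   definition of `β_c`, `spontaneousMagnetization_eq_zero_of_lt_criticalBeta_holds`).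
5. **Monotone limit on the gauge side**: `⟨W_γ⟩_β ≥` every region expectation
   (`zdExpect_le_znWilsonLoopLimit`, Griffiths II) and translation invariance
   (`znWilsonLoopLimit_add_eq`) to place the loop at height `1` over the footprint
   `[0,R) × [0,T)`, where the dual bonds of its sheet are exactly `DisorderFK.piercingBonds`
   (`image_piercingBonds_eq`).

Everything is done for `R × T` rectangles (the printed proof is stated for squares but is verbatim
the same): `Aizenman2025_z2GaugeThree_perimeterLaw_rect` gives `⟨W_{R×T}⟩_β ≥ e^{-m(β)(R+T)}`, whence
the square statement and, by Forsström–Viklund's Cor. 6.4 (`isingQuarkPotential_tendsto`), the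
**boundedness of the quark potential** `V_β(R) ≤ m(β)` for all `R` in the deconfined regime
(`isingQuarkPotential_le_of_gt_critical`).

The area-law half of Thm 9.1 (Lebowitz–Pfister 1981 surface tension, transferred by the same
duality) is NOT proved here; `Aizenman2025_z2GaugeThree_sharpTransition_of_areaLaw` records that it
is the only remaining input of the named fact.

HONEST FRAMING: `ℤ₂`, `d = 3`, an abelian calibration result (cell `ym-ir`, census row A5:
deconfinement for ALL `β > β_c`, mechanism = duality + FK∕FKG + Ising sharpness); nothing here
bears on four-dimensional Yang–Mills, on `BalabanLadder.IR`, or on the mass gap (Clay). In the `ym`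
ladder only the conditional finite-`𝕋⁴` rung `BalabanLadder.UV` is closed by any route.

## References

* M. Aizenman, Math. Phys. Anal. Geom. 28 (2025), arXiv:2509.02850, §9.1 Thm 9.1, §9.2 Thm 9.2,
  §9.3 (proof of the deconfinement bound), Lemma 9.3 [Aizenman2025].
* M. Aizenman, D. J. Barsky, R. Fernández, J. Stat. Phys. 47 (1987) 343–374, Thm. 1
  [AizenmanBarskyFernandezJSP1987]; H. Duminil-Copin, V. Tassion, CMP 343 (2016) 725
  [DuminilCopinTassionCMP2016].
* J. L. Lebowitz, A. Martin-Löf, CMP 25 (1972) 276–282 [LebowitzMartinlof1972].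
-/

noncomputable section

open MeasureTheory Finset Filter Topology
open scoped symmDiff
open Literature.Probability.LatticeModels Literature.Probability.LatticeModels.DisorderFK
open Literature.Barriers.QuantumFields (rootsOfUnityCircle znRep)

namespace Literature.MathematicalPhysics.QuantumFieldTheory

open AreaLaw

namespace Z2Duality

/-! ### §1 The dual temperature is subcritical in the deconfined regime -/

/-- `tanh β > 0` for `β > 0`. [folklore] -/
private theorem tanh_pos_of_pos'' {β : ℝ} (hβ : 0 < β) : 0 < Real.tanh β := by
  rw [Real.tanh_eq_sinh_div_cosh]; exact div_pos (Real.sinh_pos_iff.2 hβ) (Real.cosh_pos β)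

/-- **`β > β_c^{LGM} ⟹ β* < β_c^{Ising}(ℤ³)`**: the gauge coupling exceeds
`z2GaugeCriticalBetaThree = artanh e^{-2β_c^{Ising}}` iff `tanh β > e^{-2β_c^{Ising}}` iff the dual
temperature `β* = -½ log tanh β` is below the Ising critical point («the complementary phase, in
which the dual Ising model's spin-spin correlations decay exponentially fast»).
[cite: Aizenman2025, §9.1 Thm 9.1 (coth β_c = e^{2β_c^{Ising}}) and §9.3] -/
theorem dualBeta_lt_criticalBeta {β : ℝ} (h : z2GaugeCriticalBetaThree < β) :
    dualBeta β < criticalBeta 3 := by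
  have hmem := exp_neg_two_mul_criticalBeta_three_mem_Ioo
  have hβ : 0 < β := z2GaugeCriticalBetaThree_pos.trans h
  have htanh : Real.exp (-2 * criticalBeta 3) < Real.tanh β := by
    have h1 : Real.artanh (Real.exp (-2 * criticalBeta 3)) < Real.artanh (Real.tanh β) := by
      rw [Real.artanh_tanh]; exact h
    exact (Real.artanh_lt_artanh_iff ⟨by linarith [hmem.1], hmem.2⟩
      ⟨Real.neg_one_lt_tanh β, Real.tanh_lt_one β⟩).1 h1
  have hlog : -2 * criticalBeta 3 < Real.log (Real.tanh β) := by
    rw [← Real.exp_lt_exp, Real.exp_log (tanh_pos_of_pos'' hβ)]; exact htanh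
  rw [dualBeta]; linarith

/-! ### §2 The rectangle at height one and its dual bonds -/

section Square

/-- The base point `e₂` (height `1`, footprint the origin): by translation invariance the loop
may be placed anywhere. [cite: Aizenman2025, §9.1 (S_ℓ = (1,L]² × {0}, up to translation)] -/
def basePt : Probability.LatticeModels.Site 3 := Pi.single 2 1

/-- The sheet of the `R × T` loop at height one: the horizontal faces `(e₂ + t e₁ + s e₀; 0, 1)`,
`s < R`, `t < T`. [cite: Aizenman2025, §9.3 (the square S_ℓ spanned by γ_ℓ)] -/
def sheet (R T : ℕ) : Finset (Plaq 3) := rectPlaqs basePt 0 1 R T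

/-- The footprint `[0, R) × [0, T)` of the rectangle. [cite: Aizenman2025, §9.3 (Γ_ℓ projects onto S_ℓ)] -/
def sqFootprint (R T : ℕ) : Set (ℤ × ℤ) := {p | 0 ≤ p.1 ∧ p.1 < R ∧ 0 ≤ p.2 ∧ p.2 < T}

/-- The site of `ℤ³` with footprint `(a, b)` and height `c` (coordinates `x₀, x₁` span the plane of
the square, `x₂` is the height). [cite: Aizenman2025, §9.3 (Γ_ℓ = Λ* ∩ [S_ℓ × ℝ]: footprint × height)] -/
def site3 (a b c : ℤ) : Probability.LatticeModels.Site 3 := ![a, b, c]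

/-- Coordinates of `site3`. [folklore] -/
@[simp] private theorem site3_zero (a b c : ℤ) : site3 a b c 0 = a := rfl
/-- Coordinates of `site3`. [folklore] -/
@[simp] private theorem site3_one (a b c : ℤ) : site3 a b c 1 = b := rfl
/-- Coordinates of `site3`. [folklore] -/
@[simp] private theorem site3_two (a b c : ℤ) : site3 a b c 2 = c := rfl

/-- Every site is a `site3`. [folklore] -/
private theorem site3_eta (x : Probability.LatticeModels.Site 3) : site3 (x 0) (x 1) (x 2) = x := by
  funext t; fin_cases t <;> rfl

/-- The two endpoints of a vertical bond differ. [folklore] -/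
private theorem site3_ne (a b : ℤ) : site3 a b 0 ≠ site3 a b 1 := by
  intro h; have h2 := congrFun h 2; simp at h2

/-- The tiling map of `rectPlaqs basePt 0 1` in coordinates. [folklore] -/
private theorem basePt_add (s t : ℕ) :
    (basePt + Pi.single 1 (t : ℤ) + Pi.single 0 (s : ℤ) : Probability.LatticeModels.Site 3) =
      site3 s t 1 := by
  funext k; fin_cases k <;> simp [basePt, site3]

/-- Membership in the sheet: the faces `((s,t,1); 0, 1)`, `s < R`, `t < T`. [cite: Aizenman2025, §9.3] -/
theorem mem_sheet_iff {R T : ℕ} {f : Plaq 3} :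
    f ∈ sheet R T ↔ ∃ s t : ℕ, s < R ∧ t < T ∧ f = (site3 s t 1, 0, 1) := by
  unfold sheet rectPlaqs
  simp only [Finset.mem_image, Finset.mem_product, Finset.mem_range, Prod.exists, basePt_add]
  constructor
  · rintro ⟨t, s, ⟨ht, hs⟩, rfl⟩; exact ⟨s, t, hs, ht, rfl⟩
  · rintro ⟨s, t, hs, ht, rfl⟩; exact ⟨t, s, ⟨ht, hs⟩, rfl⟩

/-- The cube below the sheet face over `(s,t)` is `(s,t,0)`. [cite: Aizenman2025, §9.3] -/
theorem lowCube_sheetFace (s t : ℤ) : lowCube ((site3 s t 1, 0, 1) : Plaq 3) = site3 s t 0 := by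
  have h3 : third (0 : Fin 3) 1 = 2 := by decide
  show site3 s t 1 - Pi.single (third 0 1) 1 = _
  rw [h3]
  funext k; fin_cases k <;> simp [site3]

/-- The dual bond of the sheet face over `(s,t)` is the vertical bond from `(s,t,0)` to `(s,t,1)`.
[cite: Aizenman2025, §9.3 (the dual edges which cross S)] -/
theorem dualEdge_sheetFace (s t : ℤ) :
    dualEdge ((site3 s t 1, 0, 1) : Plaq 3) = s(site3 s t 0, site3 s t 1) := by
  rw [dualEdge, lowCube_sheetFace]

/-- The sheet lies in the gauge box `gaugeBox M` once `R, T ≤ M`. [cite: Aizenman2025, §9.3 («for any domain Λ ⊂ ℤ³ which is large enough to contain it»)] -/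
theorem sheet_subset_faces {R T M : ℕ} (hRM : R ≤ M) (hTM : T ≤ M) :
    sheet R T ⊆ plaquettesIn (gaugeBox M) := by
  intro f hf
  obtain ⟨s, t, hs, ht, rfl⟩ := mem_sheet_iff.1 hf
  rw [mem_faces_iff]
  refine ⟨by decide, fun k => ?_⟩
  fin_cases k <;> simp [site3] <;> omega

variable {R T M : ℕ}

/-- Sites with footprint in the rectangle and height `0` or `1` lie in `box 3 M`
(`R, T ≤ M`, `1 ≤ M`). [folklore] -/
private theorem site3_mem_box {s t : ℕ} (hs : s < R) (ht : t < T) (hRM : R ≤ M) (hTM : T ≤ M)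
    {c : ℤ} (hc0 : 0 ≤ c) (hc1 : c ≤ 1) (hM : 1 ≤ M) : site3 s t c ∈ box 3 M := by
  rw [mem_box]; intro k; fin_cases k <;> simp [site3] <;> omega

/-- A piercing pair of the rectangle is the dual bond of a sheet face. [cite: Aizenman2025, §9.3] -/
private theorem exists_sheet_of_isPiercingPair {u v : ↥(box 3 M)}
    (h : IsPiercingPair (sqFootprint R T) u.1 v.1) : ∃ f ∈ sheet R T, dualEdge f = s(u.1, v.1) := by
  obtain ⟨hF, hu2, hv⟩ := h
  obtain ⟨h0, h0', h1, h1'⟩ : 0 ≤ u.1 0 ∧ u.1 0 < R ∧ 0 ≤ u.1 1 ∧ u.1 1 < T := hF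
  refine ⟨(site3 (u.1 0).toNat (u.1 1).toNat 1, 0, 1),
    mem_sheet_iff.2 ⟨_, _, by omega, by omega, rfl⟩, ?_⟩
  rw [show ((u.1 0).toNat : ℤ) = u.1 0 from Int.toNat_of_nonneg h0,
    show ((u.1 1).toNat : ℤ) = u.1 1 from Int.toNat_of_nonneg h1, dualEdge_sheetFace]
  have hu : site3 (u.1 0) (u.1 1) 0 = u.1 := by rw [← hu2]; exact site3_eta u.1
  have hv' : v.1 = site3 (u.1 0) (u.1 1) 1 := by
    rw [hv]; funext k; fin_cases k <;> simp [site3, hu2]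
  rw [hu, ← hv']

/-- **The dual bonds of the sheet are Aizenman's piercing bonds** of the dual box: under the
inclusion `box 3 M ↪ ℤ³`, `piercingBonds (box 3 M) ([0,R) × [0,T))` maps onto
`(sheet R T).image dualEdge` (`R, T ≤ M`, `1 ≤ M`). [cite: Aizenman2025, §9.3 (S = the bonds of Λ* which cross S_ℓ)] -/
theorem image_piercingBonds_eq (hRM : R ≤ M) (hTM : T ≤ M) (hM : 1 ≤ M) :
    (piercingBonds (box 3 M) (sqFootprint R T)).image (Sym2.map Subtype.val) =
      (sheet R T).image dualEdge := by
  ext e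
  simp only [Finset.mem_image]
  constructor
  · rintro ⟨e', he', rfl⟩
    obtain ⟨-, hp⟩ := (mem_piercingBonds (box 3 M) (sqFootprint R T)).1 he'
    induction e' using Sym2.ind with
    | _ u v =>
      rw [isPiercing_mk] at hp
      rcases hp with huv | hvu
      · obtain ⟨f, hf, hfe⟩ := exists_sheet_of_isPiercingPair huv
        exact ⟨f, hf, by rw [Sym2.map_mk, hfe]⟩
      · obtain ⟨f, hf, hfe⟩ := exists_sheet_of_isPiercingPair hvu
        exact ⟨f, hf, by rw [Sym2.map_mk, hfe, Sym2.eq_swap]⟩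
  · rintro ⟨f, hf, rfl⟩
    obtain ⟨s, t, hs, ht, rfl⟩ := mem_sheet_iff.1 hf
    have hu : site3 s t 0 ∈ box 3 M := site3_mem_box hs ht hRM hTM le_rfl zero_le_one hM
    have hv : site3 s t 1 ∈ box 3 M := site3_mem_box hs ht hRM hTM zero_le_one le_rfl hM
    have hstep : site3 (s : ℤ) t 1 = site3 s t 0 + Pi.single 2 1 := by
      funext k; fin_cases k <;> simp [site3]
    refine ⟨s(⟨site3 s t 0, hu⟩, ⟨site3 s t 1, hv⟩), ?_, ?_⟩
    · rw [mem_piercingBonds]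
      refine ⟨?_, ?_⟩
      · rw [SimpleGraph.mem_edgeFinset, SimpleGraph.mem_edgeSet]
        exact (zdGraph_adj_iff _ _).2 ⟨2, Or.inl hstep⟩
      · rw [isPiercing_mk]
        refine Or.inl ⟨?_, rfl, hstep⟩
        show 0 ≤ ((s : ℕ) : ℤ) ∧ ((s : ℕ) : ℤ) < R ∧ 0 ≤ ((t : ℕ) : ℤ) ∧ ((t : ℕ) : ℤ) < T
        omega
    · rw [Sym2.map_mk, dualEdge_sheetFace]

end Square

/-! ### §3 The free-boundary cylinder bound in the volume vocabulary -/

section FreeBound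

variable {R T M : ℕ}

/-- The inclusion of a region into `ℤ³`. [folklore] -/
private def emb (Λ : Finset (Probability.LatticeModels.Site 3)) :
    ↥Λ ↪ Probability.LatticeModels.Site 3 :=
  Function.Embedding.subtype (· ∈ Λ)

/-- The inclusion is an isomorphism of the induced graphs. [folklore] -/
private theorem adj_emb_iff (Λ : Finset (Probability.LatticeModels.Site 3)) :
    ∀ x ∈ (Finset.univ : Finset ↥Λ), ∀ y ∈ (Finset.univ : Finset ↥Λ),
      ((zdGraph 3).Adj (emb Λ x) (emb Λ y) ↔ (regionGraph Λ).Adj x y) :=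
  fun _ _ _ _ => Iff.rfl

/-- The image of the region under its inclusion is the region. [folklore] -/
private theorem univ_map_emb (Λ : Finset (Probability.LatticeModels.Site 3)) :
    (Finset.univ : Finset ↥Λ).map (emb Λ) = Λ := by
  rw [Finset.univ_eq_attach]; exact Finset.attach_map_val

/-- Transport of the disorder observable along the inclusion: `μ_{T.map val} ∘ extend = μ_T`.
[folklore] -/
private theorem disorderWeight_image_comp_extendAlong (Λ : Finset (Probability.LatticeModels.Site 3))
    (β : ℝ) (S : Finset (Sym2 ↥Λ)) (σ : SpinConfig ↥Λ) :
    disorderWeight β (S.image (Sym2.map Subtype.val)) (SpinConfig.extendAlong (emb Λ) σ) =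
      disorderWeight β S σ := by
  rw [disorderWeight, disorderWeight,
    Finset.prod_image fun e _ e' _ h => Sym2.map.injective Subtype.val_injective h]
  refine Finset.prod_congr rfl fun e _ => ?_
  rw [show Sym2.map Subtype.val e = Sym2.map (emb Λ) e from rfl, bondSpin_extendAlong_map]

/-- **Aizenman's cylinder bound for the free-boundary dual Ising box, in the volume vocabulary**:
for `β ≥ 0`, `ρ ∈ (0,1)` dominating the relevant two-point functions, and finite sets
`A ⊇ (∂Γ)₁`, `C ⊇ (∂Γ)₂` containing the two walls of the cylinder over `[0,R) × [0,T)` in `box 3 M`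
(`R, T ≤ M`, `1 ≤ M`),
`exp( (log(1-ρ)/ρ) ∑_{a∈A} ∑_{c∈C} ⟨σ_aσ_c⟩^∅_{box 3 M,β} ) ≤ ⟨T_{S*}⟩^∅_{box 3 M,β}`, `S*` the dual
bonds of the sheet. [cite: Aizenman2025, §9.3 (proof of Thm 9.1: (eq:string)–(eq:string3) and the final display), Lemma 9.3] -/
theorem exp_mul_sum_twoPoint_le_isingExpect_free_sheet (hRM : R ≤ M) (hTM : T ≤ M) (hM : 1 ≤ M)
    {β : ℝ} (hβ : 0 ≤ β) {A C : Finset ↥(box 3 M)}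
    (hA : wall (regionGraph (box 3 M)) (cylinder (box 3 M) (sqFootprint R T)) (above (box 3 M)) true ⊆ ↑A)
    (hC : wall (regionGraph (box 3 M)) (cylinder (box 3 M) (sqFootprint R T)) (above (box 3 M)) false ⊆ ↑C)
    {ρ : ℝ} (hρ0 : 0 < ρ) (hρ1 : ρ < 1)
    (hle : ∀ a ∈ A, ∀ c ∈ C, isingTwoPoint (zdGraph 3) (box 3 M) β 0 .free a.1 c.1 ≤ ρ) :
    Real.exp (Real.log (1 - ρ) / ρ *
        ∑ a ∈ A, ∑ c ∈ C, isingTwoPoint (zdGraph 3) (box 3 M) β 0 .free a.1 c.1) ≤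
      isingExpect (zdGraph 3) (box 3 M) β 0 .free (disorderWeight β ((sheet R T).image dualEdge)) := by
  have h2pt : ∀ a c : ↥(box 3 M), isingTwoPoint (zdGraph 3) (box 3 M) β 0 .free a.1 c.1 =
      isingTwoPoint (regionGraph (box 3 M)) Finset.univ β 0 .free a c := by
    intro a c
    have h := isingTwoPoint_free_map (G := regionGraph (box 3 M)) (G' := zdGraph 3) (emb (box 3 M))
      (Λ := Finset.univ) (adj_emb_iff (box 3 M)) β 0 a c
    rwa [univ_map_emb] at h
  have hdis : isingExpect (zdGraph 3) (box 3 M) β 0 .free (disorderWeight β ((sheet R T).image dualEdge)) =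
      isingExpect (regionGraph (box 3 M)) Finset.univ β 0 .free
        (disorderWeight β (piercingBonds (box 3 M) (sqFootprint R T))) := by
    have h := isingExpect_free_map (G := regionGraph (box 3 M)) (G' := zdGraph 3) (emb (box 3 M))
      (Λ := Finset.univ) (adj_emb_iff (box 3 M)) β 0
      (measurable_disorderWeight β ((sheet R T).image dualEdge))
    rw [univ_map_emb] at h
    rw [h, ← image_piercingBonds_eq hRM hTM hM]
    exact congrArg _ (funext fun σ => disorderWeight_image_comp_extendAlong (box 3 M) β _ σ)
  have hsum : (∑ a ∈ A, ∑ c ∈ C, isingTwoPoint (zdGraph 3) (box 3 M) β 0 .free a.1 c.1) =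
      ∑ a ∈ A, ∑ c ∈ C, isingTwoPoint (regionGraph (box 3 M)) Finset.univ β 0 .free a c :=
    Finset.sum_congr rfl fun a _ => Finset.sum_congr rfl fun c _ => h2pt a c
  rw [hdis, hsum]
  exact exp_mul_sum_twoPoint_le_disorder_square (box 3 M) (sqFootprint R T) hβ hA hC hρ0 hρ1
    (fun a ha c hc => by rw [← h2pt]; exact hle a ha c hc)

end FreeBound

/-! ### §4 The disorder operator as a combination of spin products; plus = free in the limit -/

section Bridge

variable {R T : ℕ}

/-- The endpoints of the dual bonds of a set of faces. [cite: Aizenman2025, §9.3 (T_S as a spin observable)] -/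
def verts (U : Finset (Plaq 3)) : Finset (Probability.LatticeModels.Site 3) :=
  U.biUnion fun f => {lowCube f, f.1}

/-- The coefficient of `σ_{verts U}` in the expansion of `T_{S*} = ∏_{b ∈ S*} e^{-2β σ_b}`,
`e^{-2βs} = cosh 2β - s sinh 2β` (`s = ±1`). [cite: Aizenman2025, §9.3 (T_S)] -/
def coef (β : ℝ) (R T : ℕ) (U : Finset (Plaq 3)) : ℝ :=
  (-Real.sinh (2 * β)) ^ U.card * Real.cosh (2 * β) ^ (sheet R T \ U).card

/-- `e^{-2βb} = -sinh(2β) b + cosh(2β)` for `b = ±1`. [folklore] -/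
private theorem exp_neg_two_mul_eq {b : ℝ} (hb : b = 1 ∨ b = -1) (β : ℝ) :
    Real.exp (-2 * β * b) = -Real.sinh (2 * β) * b + Real.cosh (2 * β) := by
  rcases hb with rfl | rfl
  · rw [mul_one, show -2 * β = -(2 * β) by ring, ← Real.cosh_sub_sinh]; ring
  · rw [show -2 * β * -1 = 2 * β by ring, ← Real.cosh_add_sinh]; ring

/-- Distinct sheet faces have disjoint dual bonds. [folklore] -/
private theorem sheet_pairwiseDisjoint (R T : ℕ) :
    (↑(sheet R T) : Set (Plaq 3)).PairwiseDisjoint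
      fun f => ({lowCube f, f.1} : Finset (Probability.LatticeModels.Site 3)) := by
  intro f hf g hg hne
  obtain ⟨s, t, -, -, rfl⟩ := mem_sheet_iff.1 hf
  obtain ⟨s', t', -, -, rfl⟩ := mem_sheet_iff.1 hg
  dsimp only [Function.onFun]
  rw [lowCube_sheetFace, lowCube_sheetFace]
  refine Finset.disjoint_left.2 fun x hx hx' => hne ?_
  simp only [Finset.mem_insert, Finset.mem_singleton] at hx hx'
  have key : ∀ {c c' : ℤ}, site3 s t c = site3 s' t' c' → (s : ℤ) = s' ∧ (t : ℤ) = t' :=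
    fun h => ⟨by simpa using congrFun h 0, by simpa using congrFun h 1⟩
  obtain ⟨hs, ht⟩ : (s : ℤ) = s' ∧ (t : ℤ) = t' := by
    rcases hx with rfl | rfl <;> rcases hx' with h | h <;> exact key h
  obtain rfl : s = s' := by exact_mod_cast hs
  obtain rfl : t = t' := by exact_mod_cast ht
  rfl

/-- Sheet faces are positively oriented (`0 < 1`). [folklore] -/
private theorem sheetFace_mem (s t : ℕ) :
    ((site3 s t 1, 0, 1) : Plaq 3) ∈ {f : Plaq 3 | f.2.1 < f.2.2} :=
  show (0 : Fin 3) < 1 by decide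

/-- **`T_{S*}` is a finite linear combination of spin products**:
`∏_{b ∈ S*} e^{-2βσ_b} = ∑_{U ⊆ S} (-sinh 2β)^{|U|} (cosh 2β)^{|S∖U|} σ_{verts U}`.
[cite: Aizenman2025, §9.3 (T_S); folklore expansion] -/
theorem disorderWeight_sheet_eq_sum (β : ℝ) (R T : ℕ) (σ : SpinConfig (Probability.LatticeModels.Site 3)) :
    disorderWeight β ((sheet R T).image dualEdge) σ =
      ∑ U ∈ (sheet R T).powerset, coef β R T U * spinProduct (verts U) σ := by
  have hinj : ∀ f ∈ sheet R T, ∀ g ∈ sheet R T, dualEdge f = dualEdge g → f = g := by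
    intro f hf g hg h
    obtain ⟨s, t, -, -, rfl⟩ := mem_sheet_iff.1 hf
    obtain ⟨s', t', -, -, rfl⟩ := mem_sheet_iff.1 hg
    exact dualEdge_injOn (sheetFace_mem s t) (sheetFace_mem s' t') h
  rw [disorderWeight, Finset.prod_image hinj]
  have hterm : ∀ f ∈ sheet R T, Real.exp (-2 * β * bondSpin σ (dualEdge f)) =
      -Real.sinh (2 * β) * spinProduct {lowCube f, f.1} σ + Real.cosh (2 * β) := by
    intro f hf
    obtain ⟨s, t, -, -, rfl⟩ := mem_sheet_iff.1 hf
    rw [exp_neg_two_mul_eq (bondSpin_eq_one_or σ _) β, dualEdge_sheetFace, lowCube_sheetFace,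
      bondSpin_mk_eq_spinProduct (site3_ne s t)]
  rw [Finset.prod_congr rfl hterm, Finset.prod_add]
  refine Finset.sum_congr rfl fun U hU => ?_
  have hUS : U ⊆ sheet R T := Finset.mem_powerset.1 hU
  have hsp : spinProduct (verts U) σ = ∏ f ∈ U, spinProduct {lowCube f, f.1} σ := by
    unfold verts spinProduct
    exact Finset.prod_biUnion ((sheet_pairwiseDisjoint R T).subset (Finset.coe_subset.2 hUS))
  rw [hsp, Finset.prod_mul_distrib, Finset.prod_const, Finset.prod_const, coef]
  ring

/-- Linearity: the expectation of a finite combination of spin products. [folklore] -/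
private theorem isingExpect_sum_mul_spinProduct' {ι : Type*} (s : Finset ι) (c : ι → ℝ)
    (B : ι → Finset (Probability.LatticeModels.Site 3)) (Λ : Finset (Probability.LatticeModels.Site 3))
    (β : ℝ) (bc : BoundaryCondition (Probability.LatticeModels.Site 3)) :
    isingExpect (zdGraph 3) Λ β 0 bc (fun σ => ∑ i ∈ s, c i * spinProduct (B i) σ) =
      ∑ i ∈ s, c i * isingCorr (zdGraph 3) Λ β 0 bc (B i) := by
  unfold isingExpect isingCorr isingExpect
  rw [integral_finsetSum _ fun i _ => (integrable_spinProduct _ (B i)).const_mul (c i)]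
  exact Finset.sum_congr rfl fun i _ => integral_const_mul _ _

/-- **`⟨T_{S*}⟩_Λ = ∑_U coef_U ⟨σ_{verts U}⟩_Λ`** in every volume and boundary condition.
[cite: Aizenman2025, §9.3 (T_S)] -/
theorem isingExpect_disorderWeight_sheet (Λ : Finset (Probability.LatticeModels.Site 3)) (β : ℝ)
    (bc : BoundaryCondition (Probability.LatticeModels.Site 3)) (R T : ℕ) :
    isingExpect (zdGraph 3) Λ β 0 bc (disorderWeight β ((sheet R T).image dualEdge)) =
      ∑ U ∈ (sheet R T).powerset, coef β R T U * isingCorr (zdGraph 3) Λ β 0 bc (verts U) := by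
  rw [show disorderWeight β ((sheet R T).image dualEdge) =
      fun σ => ∑ U ∈ (sheet R T).powerset, coef β R T U * spinProduct (verts U) σ from
    funext (disorderWeight_sheet_eq_sum β R T)]
  exact isingExpect_sum_mul_spinProduct' _ _ _ Λ β bc

/-- The common infinite-volume value `⟨T_{S*}⟩_{ℤ³,β} = ∑_U coef_U ⟨σ_{verts U}⟩^∅_β`.
[cite: Aizenman2025, §9.3 (⟨T_{S_γ}⟩_{(ℤ³)*,β*})] -/
def sheetLimit (β : ℝ) (R T : ℕ) : ℝ :=
  ∑ U ∈ (sheet R T).powerset, coef β R T U * freeCorr 3 β 0 (verts U)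

/-- **Free box limit**: `⟨T_{S*}⟩^∅_{box M,β} → ⟨T_{S*}⟩_{ℤ³,β}` (`β ≥ 0`; GKS monotone limits of the
spin products). [cite: Aizenman2025, §9.3; FriedliVelenik2017 Exercise 3.16] -/
theorem hasBoxLimit_isingExpect_free_disorderWeight_sheet {β : ℝ} (hβ : 0 ≤ β) (R T : ℕ) :
    HasBoxLimit
      (fun Λ => isingExpect (zdGraph 3) Λ β 0 .free (disorderWeight β ((sheet R T).image dualEdge)))
      (sheetLimit β R T) := by
  unfold HasBoxLimit sheetLimit
  simp_rw [isingExpect_disorderWeight_sheet]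
  exact tendsto_finsetSum _ fun U _ =>
    Filter.Tendsto.const_mul _ (hasBoxLimit_isingCorr_free_holds hβ le_rfl (verts U))

/-- **Plus box limit below the Ising critical temperature**: for `0 ≤ β < β_c^{Ising}(ℤ³)`,
`⟨T_{S*}⟩⁺_{box M,β} → ⟨T_{S*}⟩_{ℤ³,β}` — the same limit as with free boundary condition, because
`m*(β) = 0` and then `⟨σ_A⟩⁺ = ⟨σ_A⟩^∅` for all `A` (Lebowitz–Martin-Löf). [cite: Aizenman2025, §9.3 (uniqueness of the dual state at β* < β_c); LebowitzMartinlof1972, Theorem] -/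
theorem hasBoxLimit_isingExpect_plus_disorderWeight_sheet {β : ℝ} (hβ : 0 ≤ β)
    (hβc : β < criticalBeta 3) (R T : ℕ) :
    HasBoxLimit
      (fun Λ => isingExpect (zdGraph 3) Λ β 0 .plus (disorderWeight β ((sheet R T).image dualEdge)))
      (sheetLimit β R T) := by
  have hm := spontaneousMagnetization_eq_zero_of_lt_criticalBeta_holds (d := 3) hβ hβc
  unfold HasBoxLimit sheetLimit
  simp_rw [isingExpect_disorderWeight_sheet, freeCorr_eq_plusCorr_of_spontaneousMagnetization_eq_zero hβ hm]
  exact tendsto_finsetSum _ fun U _ =>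
    Filter.Tendsto.const_mul _ (hasBoxLimit_isingCorr_plus_holds hβ le_rfl (verts U))

end Bridge

/-! ### §5 The two walls of the cylinder and the uniform bound on the double sum -/

section Walls

variable {R T M : ℕ}

/-- The rim of the footprint rectangle: the points of `[0,R) × [0,T)` with `x₀ ∈ {0, R-1}` or
`x₁ ∈ {0, T-1}` (a superset of it, of cardinality `≤ 2(R+T)`). [cite: Aizenman2025, §9.3 (∂Γ_ℓ lies over ∂S_ℓ)] -/
def rim (R T : ℕ) : Finset (ℤ × ℤ) :=
  ({0, (R : ℤ) - 1} ×ˢ Finset.Ico (0 : ℤ) T) ∪ (Finset.Ico (0 : ℤ) R ×ˢ {0, (T : ℤ) - 1})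

/-- `|rim| ≤ 2(R + T) = per(γ)`. [cite: Aizenman2025, §9.3 («the sum is of the order of the perimeter»)] -/
theorem card_rim_le (R T : ℕ) : (rim R T).card ≤ 2 * (R + T) := by
  unfold rim
  refine (Finset.card_union_le _ _).trans ?_
  rw [Finset.card_product, Finset.card_product, Int.card_Ico, Int.card_Ico, sub_zero, sub_zero]
  have h2 : ({0, (R : ℤ) - 1} : Finset ℤ).card ≤ 2 := Finset.card_le_two
  have h2' : ({0, (T : ℤ) - 1} : Finset ℤ).card ≤ 2 := Finset.card_le_two
  have hR : ((R : ℤ)).toNat = R := by simp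
  have hT : ((T : ℤ)).toNat = T := by simp
  rw [hR, hT]
  nlinarith

/-- A site of the cylinder with a neighbour outside it projects to the rim. [cite: Aizenman2025, §9.3 (geometry of Γ_ℓ)] -/
private theorem footprint_mem_rim {x y : Probability.LatticeModels.Site 3}
    (hx : footprint x ∈ sqFootprint R T) (hy : footprint y ∉ sqFootprint R T)
    (hadj : (zdGraph 3).Adj x y) : footprint x ∈ rim R T := by
  simp only [sqFootprint, footprint, Set.mem_setOf_eq] at hx hy
  simp only [rim, footprint, Finset.mem_union, Finset.mem_product, Finset.mem_insert,
    Finset.mem_singleton, Finset.mem_Ico]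
  obtain ⟨i, h | h⟩ := (zdGraph_adj_iff x y).1 hadj
  · have h0 := congrFun h 0
    have h1 := congrFun h 1
    fin_cases i <;> simp [Pi.add_apply] at h0 h1 <;> omega
  · have h0 := congrFun h 0
    have h1 := congrFun h 1
    fin_cases i <;> simp [Pi.add_apply] at h0 h1 <;> omega

/-- The finite sets `W^±` containing the two walls: sites of the box over the rim, above (`x₂ ≥ 1`)
resp. below (`x₂ ≤ 0`) the rectangle. [cite: Aizenman2025, §9.3 ((∂Γ_ℓ)₁, (∂Γ_ℓ)₂)] -/
def wallSet (R T M : ℕ) (up : Bool) : Finset ↥(box 3 M) :=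
  Finset.univ.filter fun v => footprint v.1 ∈ rim R T ∧ above (box 3 M) v = up

/-- Membership in `W^±`. [cite: Aizenman2025, §9.3] -/
theorem mem_wallSet {up : Bool} {v : ↥(box 3 M)} :
    v ∈ wallSet R T M up ↔ footprint v.1 ∈ rim R T ∧ above (box 3 M) v = up := by
  rw [wallSet, Finset.mem_filter]; exact and_iff_right (Finset.mem_univ _)

/-- **The walls of the cylinder lie in `W^±`.** [cite: Aizenman2025, §9.3 ((∂Γ_ℓ)₁, (∂Γ_ℓ)₂)] -/
theorem wall_subset_wallSet (R T M : ℕ) (up : Bool) :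
    wall (regionGraph (box 3 M)) (cylinder (box 3 M) (sqFootprint R T)) (above (box 3 M)) up ⊆
      ↑(wallSet R T M up) := by
  rintro x ⟨hx, hup, y, hy, hadj⟩
  rw [Finset.mem_coe, mem_wallSet]
  exact ⟨footprint_mem_rim hx hy hadj, hup⟩

/-- Sites of `W⁺` have height `≥ 1`. [folklore] -/
private theorem one_le_of_mem_wallSet {a : ↥(box 3 M)} (ha : a ∈ wallSet R T M true) :
    1 ≤ a.1 2 := by
  have h := (mem_wallSet.1 ha).2
  rwa [above, decide_eq_true_eq] at h

/-- Sites of `W⁻` have height `≤ 0`. [folklore] -/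
private theorem le_zero_of_mem_wallSet {c : ↥(box 3 M)} (hc : c ∈ wallSet R T M false) :
    c.1 2 ≤ 0 := by
  have h := (mem_wallSet.1 hc).2
  rw [above, decide_eq_false_iff_not] at h
  omega

/-- Vertical separation of the two walls: `1 ≤ a₂ ≤ a₂ - c₂ ≤ ‖c - a‖`. [folklore] -/
private theorem height_le_norm {a c : ↥(box 3 M)} (ha : a ∈ wallSet R T M true)
    (hc : c ∈ wallSet R T M false) :
    (1 : ℝ) ≤ ((a.1 2 : ℤ) : ℝ) ∧ ((a.1 2 : ℤ) : ℝ) ≤ ‖c.1 - a.1‖ := by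
  have ha2 := one_le_of_mem_wallSet ha
  have hc2 := le_zero_of_mem_wallSet hc
  refine ⟨by exact_mod_cast ha2, ?_⟩
  have h1 : ‖(c.1 - a.1) 2‖ ≤ ‖c.1 - a.1‖ := norm_le_pi_norm _ 2
  rw [Pi.sub_apply, Int.norm_eq_abs] at h1
  refine le_trans ?_ h1
  rw [abs_of_nonpos (by exact_mod_cast (by omega : c.1 2 - a.1 2 ≤ 0))]
  push_cast
  have : ((c.1 2 : ℤ) : ℝ) ≤ 0 := by exact_mod_cast hc2
  linarith

/-- **The dual two-point function decays exponentially** (volume monotonicity + translation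
invariance + sharpness): `⟨σ_aσ_c⟩^∅_{box M,β} ≤ ⟨σ_0σ_{c-a}⟩^∅_β ≤ e^{-κ‖c-a‖}`.
[cite: Aizenman2025, §9.3 («by the known sharpness of Ising model's phase transition [ABF87]»); AizenmanBarskyFernandezJSP1987 Thm. 1] -/
theorem isingTwoPoint_box_le_exp {β κ : ℝ} (hβ : 0 ≤ β)
    (hdec : ∀ x : Probability.LatticeModels.Site 3, twoPointFree 3 β x ≤ Real.exp (-κ * ‖x‖))
    {a c : Probability.LatticeModels.Site 3} (ha : a ∈ box 3 M) (hc : c ∈ box 3 M) (hac : a ≠ c) :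
    isingTwoPoint (zdGraph 3) (box 3 M) β 0 .free a c ≤ Real.exp (-κ * ‖c - a‖) := by
  rw [isingTwoPoint_eq_isingCorr _ _ _ _ _ hac]
  calc isingCorr (zdGraph 3) (box 3 M) β 0 .free {a, c}
      ≤ freeCorr 3 β 0 {a, c} := isingCorr_free_box_le_freeCorr hβ le_rfl
          (Finset.insert_subset_iff.2 ⟨ha, Finset.singleton_subset_iff.2 hc⟩)
    _ = freeCorr 3 β 0 {a, a + (c - a)} := by rw [add_sub_cancel]
    _ = twoPointFree 3 β (c - a) := by
          rw [freeCorr_pair_shift hβ, twoPointFree_eq_freeCorr _ (sub_ne_zero.2 hac.symm)]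
    _ ≤ _ := hdec _

/-- The summand bound: `⟨σ_aσ_c⟩ ≤ e^{-(κ/2) a₂} e^{-(κ/2)‖c-a‖}` for `a ∈ W⁺`, `c ∈ W⁻`. [folklore] -/
private theorem twoPoint_wall_le {β κ : ℝ} (hβ : 0 ≤ β) (hκ : 0 < κ)
    (hdec : ∀ x : Probability.LatticeModels.Site 3, twoPointFree 3 β x ≤ Real.exp (-κ * ‖x‖))
    {a c : ↥(box 3 M)} (ha : a ∈ wallSet R T M true) (hc : c ∈ wallSet R T M false) :
    isingTwoPoint (zdGraph 3) (box 3 M) β 0 .free a.1 c.1 ≤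
      Real.exp (-(κ / 2) * ((a.1 2 : ℤ) : ℝ)) * Real.exp (-(κ / 2) * ‖c.1 - a.1‖) := by
  obtain ⟨h1, hnorm⟩ := height_le_norm ha hc
  have hac : a.1 ≠ c.1 := fun h => by
    have := one_le_of_mem_wallSet ha; have := le_zero_of_mem_wallSet hc
    have h2 := congrFun h 2; omega
  refine (isingTwoPoint_box_le_exp hβ hdec a.2 c.2 hac).trans ?_
  rw [← Real.exp_add, Real.exp_le_exp]
  nlinarith

/-- The bound `⟨σ_aσ_c⟩ ≤ ρ := e^{-κ} < 1` between the walls. [folklore] -/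
private theorem twoPoint_wall_le_R {β κ : ℝ} (hβ : 0 ≤ β) (hκ : 0 < κ)
    (hdec : ∀ x : Probability.LatticeModels.Site 3, twoPointFree 3 β x ≤ Real.exp (-κ * ‖x‖))
    {a c : ↥(box 3 M)} (ha : a ∈ wallSet R T M true) (hc : c ∈ wallSet R T M false) :
    isingTwoPoint (zdGraph 3) (box 3 M) β 0 .free a.1 c.1 ≤ Real.exp (-κ) := by
  obtain ⟨h1, hnorm⟩ := height_le_norm ha hc
  have hac : a.1 ≠ c.1 := fun h => by
    have := one_le_of_mem_wallSet ha; have := le_zero_of_mem_wallSet hc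
    have h2 := congrFun h 2; omega
  refine (isingTwoPoint_box_le_exp hβ hdec a.2 c.2 hac).trans ?_
  rw [Real.exp_le_exp]
  nlinarith

/-- The inner sum over the lower wall is bounded by the lattice sum of `e^{-(κ/2)‖y‖}`. [folklore] -/
private theorem sum_lowerWall_le {κ B : ℝ}
    (hB : ∀ L, ∑ y ∈ box 3 L, Real.exp (-(κ / 2) * ‖y‖) ≤ B) (a : ↥(box 3 M))
    (C : Finset ↥(box 3 M)) :
    ∑ c ∈ C, Real.exp (-(κ / 2) * ‖c.1 - a.1‖) ≤ B := by
  have hinj : ∀ c ∈ C, ∀ c' ∈ C, c.1 - a.1 = c'.1 - a.1 → c = c' :=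
    fun c _ c' _ h => Subtype.ext (sub_left_injective h)
  have hsub : C.image (fun c => c.1 - a.1) ⊆ box 3 (2 * M) := by
    intro y hy
    obtain ⟨c, -, rfl⟩ := Finset.mem_image.1 hy
    have hc := mem_box.1 c.2
    have ha := mem_box.1 a.2
    rw [mem_box]
    intro i
    have := hc i; have := ha i
    simp only [Pi.sub_apply]
    push_cast
    omega
  calc ∑ c ∈ C, Real.exp (-(κ / 2) * ‖c.1 - a.1‖)
      = ∑ y ∈ C.image (fun c => c.1 - a.1), Real.exp (-(κ / 2) * ‖y‖) := by
        rw [Finset.sum_image hinj]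
    _ ≤ ∑ y ∈ box 3 (2 * M), Real.exp (-(κ / 2) * ‖y‖) :=
        Finset.sum_le_sum_of_subset_of_nonneg hsub fun _ _ _ => (Real.exp_pos _).le
    _ ≤ B := hB _

/-- The outer sum over the upper wall: `∑_{a ∈ W⁺} e^{-(κ/2) a₂} ≤ 2(R+T) · r/(1-r)`, `r = e^{-κ/2}`
(`≤ 2(R+T)` columns, a geometric series in the height). [cite: Aizenman2025, §9.3 («of the order of the perimeter»)] -/
private theorem sum_upperWall_le {κ : ℝ} (hκ : 0 < κ) (R T M : ℕ) :
    ∑ a ∈ wallSet R T M true, Real.exp (-(κ / 2) * ((a.1 2 : ℤ) : ℝ)) ≤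
      2 * ((R : ℝ) + T) * (Real.exp (-(κ / 2)) / (1 - Real.exp (-(κ / 2)))) := by
  have hr0 : 0 ≤ Real.exp (-(κ / 2)) := (Real.exp_pos _).le
  have hr1 : Real.exp (-(κ / 2)) < 1 := Real.exp_lt_one_iff.2 (by linarith)
  -- inject `a ↦ (footprint a, a₂)` into `rim × [1, M]`
  have hinj : ∀ a ∈ wallSet R T M true, ∀ a' ∈ wallSet R T M true,
      (footprint a.1, (a.1 2).toNat) = (footprint a'.1, (a'.1 2).toNat) → a = a' := by
    intro a ha a' ha' h
    simp only [Prod.mk.injEq, footprint] at h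
    have h2 := one_le_of_mem_wallSet ha
    have h2' := one_le_of_mem_wallSet ha'
    apply Subtype.ext
    funext k
    fin_cases k
    · exact h.1.1
    · exact h.1.2
    · show a.1 2 = a'.1 2
      omega
  have hsub : (wallSet R T M true).image (fun a => (footprint a.1, (a.1 2).toNat)) ⊆
      rim R T ×ˢ Finset.Ico 1 (M + 1) := by
    intro q hq
    obtain ⟨a, ha, rfl⟩ := Finset.mem_image.1 hq
    have h2 := one_le_of_mem_wallSet ha
    have hM := (mem_box.1 a.2 2).2
    rw [Finset.mem_product, Finset.mem_Ico]
    exact ⟨(mem_wallSet.1 ha).1, by omega, by omega⟩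
  have hterm : ∀ a ∈ wallSet R T M true,
      Real.exp (-(κ / 2) * ((a.1 2 : ℤ) : ℝ)) = Real.exp (-(κ / 2)) ^ (a.1 2).toNat := by
    intro a ha
    have h2 : 0 ≤ a.1 2 := le_trans zero_le_one (one_le_of_mem_wallSet ha)
    have hc : (((a.1 2).toNat : ℕ) : ℝ) = ((a.1 2 : ℤ) : ℝ) := by
      exact_mod_cast Int.toNat_of_nonneg h2
    rw [← Real.exp_nat_mul, hc, mul_comm]
  calc ∑ a ∈ wallSet R T M true, Real.exp (-(κ / 2) * ((a.1 2 : ℤ) : ℝ))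
      = ∑ a ∈ wallSet R T M true, Real.exp (-(κ / 2)) ^ (footprint a.1, (a.1 2).toNat).2 :=
        Finset.sum_congr rfl hterm
    _ = ∑ q ∈ (wallSet R T M true).image (fun a => (footprint a.1, (a.1 2).toNat)),
          Real.exp (-(κ / 2)) ^ q.2 := by rw [Finset.sum_image hinj]
    _ ≤ ∑ q ∈ rim R T ×ˢ Finset.Ico 1 (M + 1), Real.exp (-(κ / 2)) ^ q.2 :=
        Finset.sum_le_sum_of_subset_of_nonneg hsub fun _ _ _ => pow_nonneg hr0 _
    _ = (rim R T).card * ∑ k ∈ Finset.Ico 1 (M + 1), Real.exp (-(κ / 2)) ^ k := by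
        rw [Finset.sum_product]
        dsimp only
        rw [Finset.sum_const, nsmul_eq_mul]
    _ ≤ (2 * ((R : ℝ) + T)) * (Real.exp (-(κ / 2)) / (1 - Real.exp (-(κ / 2)))) := by
        refine mul_le_mul (by exact_mod_cast card_rim_le R T) ?_
          (Finset.sum_nonneg fun _ _ => pow_nonneg hr0 _) (by positivity)
        have h := geom_sum_Ico_le_of_lt_one hr0 hr1 (m := 1) (n := M + 1)
        rwa [pow_one] at h

/-- **The double sum over the two walls is `O(per γ)` uniformly in the volume**:
`∑_{a ∈ W⁺} ∑_{c ∈ W⁻} ⟨σ_aσ_c⟩^∅_{box M,β} ≤ (2 r B/(1-r)) (R + T)`, `r = e^{-κ/2}`,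
`B ≥ ∑_y e^{-(κ/2)‖y‖}`. [cite: Aizenman2025, §9.3 («the spin-spin correlation decays exponentially the sum is of the order of the perimeter |γ|»)] -/
theorem wallSum_le {β κ B : ℝ} (hβ : 0 ≤ β) (hκ : 0 < κ)
    (hdec : ∀ x : Probability.LatticeModels.Site 3, twoPointFree 3 β x ≤ Real.exp (-κ * ‖x‖))
    (hB : ∀ L, ∑ y ∈ box 3 L, Real.exp (-(κ / 2) * ‖y‖) ≤ B) (R T M : ℕ) :
    ∑ a ∈ wallSet R T M true, ∑ c ∈ wallSet R T M false,
        isingTwoPoint (zdGraph 3) (box 3 M) β 0 .free a.1 c.1 ≤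
      2 * (Real.exp (-(κ / 2)) / (1 - Real.exp (-(κ / 2)))) * B * ((R : ℝ) + T) := by
  have hB0 : 0 ≤ B := le_trans (Finset.sum_nonneg fun _ _ => (Real.exp_pos _).le) (hB 0)
  calc ∑ a ∈ wallSet R T M true, ∑ c ∈ wallSet R T M false,
          isingTwoPoint (zdGraph 3) (box 3 M) β 0 .free a.1 c.1
      ≤ ∑ a ∈ wallSet R T M true, ∑ c ∈ wallSet R T M false,
          Real.exp (-(κ / 2) * ((a.1 2 : ℤ) : ℝ)) * Real.exp (-(κ / 2) * ‖c.1 - a.1‖) :=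
        Finset.sum_le_sum fun a ha => Finset.sum_le_sum fun c hc => twoPoint_wall_le hβ hκ hdec ha hc
    _ = ∑ a ∈ wallSet R T M true, Real.exp (-(κ / 2) * ((a.1 2 : ℤ) : ℝ)) *
          ∑ c ∈ wallSet R T M false, Real.exp (-(κ / 2) * ‖c.1 - a.1‖) := by
        simp_rw [Finset.mul_sum]
    _ ≤ ∑ a ∈ wallSet R T M true, Real.exp (-(κ / 2) * ((a.1 2 : ℤ) : ℝ)) * B :=
        Finset.sum_le_sum fun a _ =>
          mul_le_mul_of_nonneg_left (sum_lowerWall_le hB a _) (Real.exp_pos _).le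
    _ = (∑ a ∈ wallSet R T M true, Real.exp (-(κ / 2) * ((a.1 2 : ℤ) : ℝ))) * B := by
        rw [Finset.sum_mul]
    _ ≤ 2 * ((R : ℝ) + T) * (Real.exp (-(κ / 2)) / (1 - Real.exp (-(κ / 2)))) * B :=
        mul_le_mul_of_nonneg_right (sum_upperWall_le hκ R T M) hB0
    _ = _ := by ring

end Walls

/-! ### §6 Assembly: Theorem 9.1, second line -/

section Assembly

variable {R T M : ℕ}

/-- Thm 9.2 for the rectangle at height one: `⟨W_{R×T}⟩^{free}_{ΛG_M,β} = ⟨T_{S*}⟩⁺_{box M,β*}`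
(`R, T ≤ M`). [cite: Aizenman2025, Thm 9.2 (2)] -/
theorem zdExpect_wilsonLoop_sheet_eq {β : ℝ} (hβ : 0 < β) (hRM : R ≤ M) (hTM : T ≤ M) :
    zdExpect (znRep 2) β (gaugeBox M) (zdWilsonLoop (znRep 2) basePt 0 1 R T) =
      isingExpect (zdGraph 3) (box 3 M) (dualBeta β) 0 .plus
        (disorderWeight (dualBeta β) ((sheet R T).image dualEdge)) :=
  zdExpect_z2_wilsonLoop_eq_isingExpect_plus_disorderWeight hβ (by decide) (sheet_subset_faces hRM hTM)

/-- The deconfinement constant `m(β) ≥ 0` of this proof: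
`m = -(log(1-ρ)/ρ) · 2 r B/(1-r)`, `ρ = e^{-κ}`, `r = e^{-κ/2}`, with `κ` an exponential decay rate
of the dual free two-point function and `B ≥ sup_L ∑_{y ∈ box L} e^{-(κ/2)‖y‖}`. [cite: Aizenman2025, §9.3 (m(β) < ∞)] -/
def perimeterConst (κ B : ℝ) : ℝ :=
  -(Real.log (1 - Real.exp (-κ)) / Real.exp (-κ)) *
    (2 * (Real.exp (-(κ / 2)) / (1 - Real.exp (-(κ / 2)))) * B)

/-- `m(β) ≥ 0`. [cite: Aizenman2025, §9.3] -/
theorem perimeterConst_nonneg {κ B : ℝ} (hκ : 0 < κ) (hB : 0 ≤ B) : 0 ≤ perimeterConst κ B := by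
  have hR0 : 0 < Real.exp (-κ) := Real.exp_pos _
  have hR1 : Real.exp (-κ) < 1 := Real.exp_lt_one_iff.2 (by linarith)
  have hr1 : Real.exp (-(κ / 2)) < 1 := Real.exp_lt_one_iff.2 (by linarith)
  have hlam : Real.log (1 - Real.exp (-κ)) / Real.exp (-κ) ≤ 0 :=
    div_nonpos_of_nonpos_of_nonneg (Real.log_nonpos (by linarith) (by linarith)) hR0.le
  unfold perimeterConst
  have : 0 ≤ 2 * (Real.exp (-(κ / 2)) / (1 - Real.exp (-(κ / 2)))) * B := by
    have : 0 ≤ Real.exp (-(κ / 2)) / (1 - Real.exp (-(κ / 2))) :=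
      div_nonneg (Real.exp_pos _).le (by linarith)
    positivity
  nlinarith

/-- **Theorem 9.1, second line, for rectangles based at `e₂`**: for `β > β_c`, with `κ` the decay
rate of the dual free two-point function and `B` the lattice sum bound,
`⟨W_{R×T}⟩_{ℤ³,β} ≥ e^{-m (R+T)}` for all `R, T`, `m = perimeterConst κ B`.
[cite: Aizenman2025, §9.1 Thm 9.1 (second line) and §9.3 (its proof)] -/
theorem exp_neg_mul_le_znWilsonLoopLimit_basePt {β κ B : ℝ} (h : z2GaugeCriticalBetaThree < β)
    (hκ : 0 < κ)
    (hdec : ∀ x : Probability.LatticeModels.Site 3, twoPointFree 3 (dualBeta β) x ≤ Real.exp (-κ * ‖x‖))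
    (hB : ∀ L, ∑ y ∈ box 3 L, Real.exp (-(κ / 2) * ‖y‖) ≤ B) (R T : ℕ) :
    Real.exp (-(perimeterConst κ B * ((R : ℝ) + T))) ≤ znWilsonLoopLimit 2 β basePt 0 1 R T := by
  have hβ : 0 < β := z2GaugeCriticalBetaThree_pos.trans h
  have hβs0 : 0 < dualBeta β := dualBeta_pos hβ
  have hβsc : dualBeta β < criticalBeta 3 := dualBeta_lt_criticalBeta h
  have hR0 : 0 < Real.exp (-κ) := Real.exp_pos _
  have hR1 : Real.exp (-κ) < 1 := Real.exp_lt_one_iff.2 (by linarith)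
  have hlam : Real.log (1 - Real.exp (-κ)) / Real.exp (-κ) ≤ 0 :=
    div_nonpos_of_nonpos_of_nonneg (Real.log_nonpos (by linarith) (by linarith)) hR0.le
  -- (A) the free dual expectations are bounded below for `M ≥ R + T + 1`
  have hfree : ∀ M, R + T + 1 ≤ M → Real.exp (-(perimeterConst κ B * ((R : ℝ) + T))) ≤
      isingExpect (zdGraph 3) (box 3 M) (dualBeta β) 0 .free
        (disorderWeight (dualBeta β) ((sheet R T).image dualEdge)) := by
    intro M hM
    refine le_trans ?_ (exp_mul_sum_twoPoint_le_isingExpect_free_sheet (by omega) (by omega)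
      (by omega) hβs0.le (wall_subset_wallSet R T M true) (wall_subset_wallSet R T M false) hR0 hR1
      (fun a ha c hc => twoPoint_wall_le_R hβs0.le hκ hdec ha hc))
    rw [Real.exp_le_exp, perimeterConst]
    have hD := mul_le_mul_of_nonpos_left (wallSum_le hβs0.le hκ hdec hB R T M) hlam
    linarith
  -- (B) pass to the limit `M → ∞` on the free side
  have hW : Real.exp (-(perimeterConst κ B * ((R : ℝ) + T))) ≤ sheetLimit (dualBeta β) R T :=
    ge_of_tendsto (hasBoxLimit_isingExpect_free_disorderWeight_sheet hβs0.le R T)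
      (Filter.eventually_atTop.2 ⟨R + T + 1, fun M hM => hfree M hM⟩)
  -- (C) the plus side: Wilson loops of the gauge boxes, below the infinite-volume Wilson loop
  have hWL : sheetLimit (dualBeta β) R T ≤ znWilsonLoopLimit 2 β basePt 0 1 R T := by
    refine le_of_tendsto (hasBoxLimit_isingExpect_plus_disorderWeight_sheet hβs0.le hβsc R T)
      (Filter.eventually_atTop.2 ⟨R + T, fun M hM => ?_⟩)
    beta_reduce
    rw [← zdExpect_wilsonLoop_sheet_eq hβ (by omega) (by omega)]
    exact zdExpect_le_znWilsonLoopLimit hβ.le _ _ (by decide) _ _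
  exact hW.trans hWL

end Assembly

end Z2Duality

open Z2Duality in
/-- **Aizenman 2025, Theorem 9.1, second line, for rectangles (deconfinement ∕ perimeter law of
`ℤ₂` lattice gauge theory on `ℤ³`) — PROVED**: for every `β > β_c = artanh e^{-2β_c^{Ising}(ℤ³)}`
there is `m(β) ∈ [0, ∞)` with `⟨W_{R×T}⟩_{ℤ³,β} ≥ e^{-m(β)(R+T)}` for all sites `x` and all `R, T`
(`znWilsonLoopLimit 2 β x 0 1 R T`, the free-boundary infinite-volume Wilson loop of the `R × T`
rectangle in the `(0,1)` plane). [cite: Aizenman2025, §9.1 Thm 9.1 (second line), proof §9.3] -/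
theorem Aizenman2025_z2GaugeThree_perimeterLaw_rect {β : ℝ} (h : z2GaugeCriticalBetaThree < β) :
    ∃ m : ℝ, 0 ≤ m ∧ ∀ (x : Probability.LatticeModels.Site 3) (R T : ℕ),
      Real.exp (-(m * ((R : ℝ) + T))) ≤ znWilsonLoopLimit 2 β x 0 1 R T := by
  have hβ : 0 < β := z2GaugeCriticalBetaThree_pos.trans h
  obtain ⟨κ, hκ, hdec⟩ := twoPoint_exponentialDecay_of_lt_criticalBeta_holds (d := 3) (by norm_num)
    (dualBeta_pos hβ).le (dualBeta_lt_criticalBeta h)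
  obtain ⟨B, hB⟩ := sum_box_exp_neg_mul_norm_le (d := 3) (c := κ / 2) (by positivity)
  have hB0 : 0 ≤ B := le_trans (Finset.sum_nonneg fun _ _ => (Real.exp_pos _).le) (hB 0)
  refine ⟨perimeterConst κ B, perimeterConst_nonneg hκ hB0, fun x R T => ?_⟩
  have key := exp_neg_mul_le_znWilsonLoopLimit_basePt h hκ hdec hB R T
  rwa [← znWilsonLoopLimit_add_eq hβ.le basePt (x - basePt) (show (0 : Fin 3) ≠ 1 by decide) R T,
    add_sub_cancel] at key

/-- **Aizenman 2025, Theorem 9.1, second line (deconfinement ∕ perimeter law of `ℤ₂` lattice gauge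
theory on `ℤ³`) — PROVED**: for every `β > β_c = artanh e^{-2β_c^{Ising}(ℤ³)}` there is
`m(β) < ∞` with `⟨W_{γ_ℓ}⟩_{ℤ³,β} ≥ e^{-m(β) ℓ}` for all sites `x` and all `ℓ ≥ 1`
(`znWilsonLoopLimit 2 β x 0 1 ℓ ℓ`, the free-boundary infinite-volume `ℓ × ℓ` Wilson loop). This is
verbatim the second conjunct of the named fact `Aizenman2025_z2GaugeThree_sharpTransition`.
Proof: §§1–6 above (duality Thm 9.2, the FK∕FKG cylinder bound of §9.3, sharpness of the dual
Ising model, Lebowitz–Martin-Löf, translation invariance). [cite: Aizenman2025, §9.1 Thm 9.1 (second line), proof §9.3] -/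
theorem Aizenman2025_z2GaugeThree_perimeterLaw :
    ∀ β : ℝ, z2GaugeCriticalBetaThree < β →
      ∃ m : ℝ, ∀ (x : Probability.LatticeModels.Site 3) (ℓ : ℕ), 1 ≤ ℓ →
        Real.exp (-(m * (ℓ : ℝ))) ≤ znWilsonLoopLimit 2 β x 0 1 ℓ ℓ := by
  intro β h
  obtain ⟨m, -, hm⟩ := Aizenman2025_z2GaugeThree_perimeterLaw_rect h
  refine ⟨2 * m, fun x ℓ _ => ?_⟩
  have key := hm x ℓ ℓ
  rwa [show m * ((ℓ : ℝ) + ℓ) = 2 * m * ℓ by ring] at key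

/-- **Deconfinement of the quark potential**: for `β > β_c` the `ℤ₂` quark potential of
Forsström–Viklund (`V_β(R) = lim_T -(1/T) log ⟨W_{R×T}⟩_β`, FV25 Cor. 6.4,
`isingQuarkPotential`) is BOUNDED, `V_β(R) ≤ m(β)` for all `R` and all base points (whereas
`0 ≤ V_β(R) ≤ -R log tanh β` a priori). [cite: Aizenman2025, §9.1 Thm 9.1 (second line: perimeter law ⇒ no confinement); ForsstromViklund2025currents Cor. 6.4] -/
theorem isingQuarkPotential_le_of_gt_critical {β : ℝ} (h : z2GaugeCriticalBetaThree < β) :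
    ∃ m : ℝ, ∀ (x : Probability.LatticeModels.Site 3) (R : ℕ), isingQuarkPotential β x 0 1 R ≤ m := by
  have hβ : 0 < β := z2GaugeCriticalBetaThree_pos.trans h
  obtain ⟨m, hm0, hm⟩ := Aizenman2025_z2GaugeThree_perimeterLaw_rect h
  refine ⟨m, fun x R => ?_⟩
  have h01 : (0 : Fin 3) ≠ 1 := by decide
  -- `-(1/T) log⟨W_{R×T}⟩ ≤ m (R + T)/T = m R/T + m → m`
  have hlim : Tendsto (fun T : ℕ => m * R / (T : ℝ) + m) atTop (𝓝 m) := by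
    have h0 : Tendsto (fun T : ℕ => m * R / (T : ℝ)) atTop (𝓝 0) :=
      tendsto_const_div_atTop_nhds_zero_nat (m * R)
    simpa using h0.add_const m
  refine le_of_tendsto_of_tendsto (isingQuarkPotential_tendsto hβ x h01 R) hlim
    (Filter.eventually_atTop.2 ⟨1, fun T hT => ?_⟩)
  have hWpos : 0 < znWilsonLoopLimit 2 β x 0 1 R T :=
    lt_of_lt_of_le (Real.exp_pos _) (hm x R T)
  have hlog : -(m * ((R : ℝ) + T)) ≤ Real.log (znWilsonLoopLimit 2 β x 0 1 R T) :=
    (Real.le_log_iff_exp_le hWpos).2 (hm x R T)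
  have hT' : (0 : ℝ) < T := by exact_mod_cast hT
  show -Real.log (znWilsonLoopLimit 2 β x 0 1 R T) / (T : ℝ) ≤ m * R / (T : ℝ) + m
  rw [show m * R / (T : ℝ) + m = m * ((R : ℝ) + T) / T by field_simp]
  exact div_le_div_of_nonneg_right (by linarith) hT'.le

/-- **The named fact reduces to its area-law half**: given the first line of Thm 9.1 (area law for
`0 ≤ β < β_c`, Lebowitz–Pfister surface tension via duality — not proved in the tree), the fact
`Aizenman2025_z2GaugeThree_sharpTransition` holds. [cite: Aizenman2025, §9.1 Thm 9.1] -/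
theorem Aizenman2025_z2GaugeThree_sharpTransition_of_areaLaw
    (harea : ∀ β : ℝ, 0 ≤ β → β < z2GaugeCriticalBetaThree →
      ∃ α : ℝ, 0 < α ∧ ∀ (x : Probability.LatticeModels.Site 3) (ℓ : ℕ), 1 ≤ ℓ →
        znWilsonLoopLimit 2 β x 0 1 ℓ ℓ ≤ Real.exp (-(α * (ℓ : ℝ) ^ 2))) :
    Aizenman2025_z2GaugeThree_sharpTransition :=
  ⟨harea, Aizenman2025_z2GaugeThree_perimeterLaw⟩

end Literature.MathematicalPhysics.QuantumFieldTheory
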